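import Mathlib
import Literature.Probability.Process.PathSpaceBorel
import Literature.Probability.RandomPlanarGeometry.CurveClassStopAtMeasurable
import HarnessLib

/-!
# Measurability into the path space `C([0,1], ℂ)` (soft-Markov brick Λa)

Crux `AxiomsOfLimit` (stmt-CriticalPhenomena-1370), line `registered`, stub `stub_markovOfLimit`,
soft-Markov brick Λa "measurability into path space" (lead c4). Theorems only.

The lead's soft-Markov line transports the scaling-limit law from curve CLASSES to PARAMETRISED
paths through a canonical clock parametrisation `Λ : CurveClass ℂ → C([0,1], ℂ)`, defined
pointwise; its measurability is obtained coordinate-wise and through a Borel lift to parametrised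
curves. This file supplies the two measurability facts used there
(`stub_measurableToPathSpace`):

* `measurable_toPath_of_eval` — for any Borel structure on `C([0,1], ℂ)` (compact-open = uniform
  topology), a map into it is measurable as soon as all its evaluations are: the Borel σ-algebra
  of `C([0,1], ℂ)` is generated by the evaluation maps (tree
  `Literature.Probability.Process.borel_continuousMap_eq_iSup_comap_eval`, Billingsley (1999),
  Example 1.3 / §7);
* `measurable_toPath_of_lift` — a map `g : CurveClass ℂ → C([0,1], ℂ)` that lifts, along the
  continuous surjection `CurveClass.mk ∘ Curve.mk : C([0,1], ℂ) → CurveClass ℂ` from the Polish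
  path space, to a Borel self-map `ĝ` of the path space is Borel. This is the codomain variant of
  the tree's `CurveClass.measurable_of_lift` (Suslin's theorem: preimages are analytic and
  co-analytic); here it is read off Mathlib's
  `Measurable.measurable_comp_iff_of_surjective` (a surjective Borel map from a standard Borel
  space to a countably separated space is a quotient map for measurability), whose proof is the
  same analytic/co-analytic argument.

References: A. S. Kechris, *Classical Descriptive Set Theory* (1995), Thm. 14.11 (Suslin), for
the lift criterion; P. Billingsley, *Convergence of Probability Measures* (1999), §7, for the
evaluation σ-algebra. All `[folklore]`.
-/

noncomputable section

open MeasureTheory Set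
open scoped unitInterval

namespace Summit.CriticalPhenomena.SAWScalingLimit.Theorems.AxiomsOfLimitMarkov

open Literature.Probability.RandomPlanarGeometry

/-- **A map into the path space `C([0,1], ℂ)` is Borel as soon as all its evaluations are
measurable** (instance form of the tree's `Process.measurable_continuousMap_of_eval`: the Borel
σ-algebra of `C([0,1], ℂ)` is generated by the evaluations). [folklore] -/
theorem measurable_toPath_of_eval {X : Type*} [MeasurableSpace X] [MeasurableSpace C(I, ℂ)]
    [BorelSpace C(I, ℂ)] {f : X → C(I, ℂ)} (hf : ∀ r : I, Measurable fun x => f x r) :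
    Measurable f :=
  (Literature.Probability.Process.measurable_continuousMap_of_eval hf).mono le_rfl
    BorelSpace.measurable_eq.le

/-- **Suslin lift criterion into path space**: a map `g : CurveClass ℂ → C([0,1], ℂ)` which
lifts along `CurveClass.mk ∘ Curve.mk` to a Borel self-map `ĝ` of `C([0,1], ℂ)` is Borel
(`CurveClass.mk ∘ Curve.mk` is a continuous surjection from the Polish path space onto the
countably separated space of curve classes, hence a quotient map for Borel measurability —
Suslin's theorem, Mathlib `Measurable.measurable_comp_iff_of_surjective`). [folklore] -/
theorem measurable_toPath_of_lift [MeasurableSpace C(I, ℂ)] [BorelSpace C(I, ℂ)]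
    {g : CurveClass ℂ → C(I, ℂ)} {ĝ : C(I, ℂ) → C(I, ℂ)} (hĝ : Measurable ĝ)
    (h : ∀ γ : C(I, ℂ), g (CurveClass.mk (Curve.mk γ)) = ĝ γ) : Measurable g := by
  have hπ : Measurable fun γ : C(I, ℂ) => CurveClass.mk (Curve.mk γ) :=
    CurveClass.continuous_mk_comp_mk.measurable
  rw [← hπ.measurable_comp_iff_of_surjective CurveClass.surjective_mk_comp_mk]
  have hcomp : (g ∘ fun γ : C(I, ℂ) => CurveClass.mk (Curve.mk γ)) = ĝ := funext h
  rw [hcomp]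
  exact hĝ

/-- **Soft-Markov brick Λa (registered stub `stub_measurableToPathSpace`).** (1) For any Borel
structure on `C([0,1], ℂ)`, a map into it all of whose evaluations are measurable is measurable;
(2) a map `CurveClass ℂ → C([0,1], ℂ)` lifting along `CurveClass.mk ∘ Curve.mk` to a Borel
self-map of `C([0,1], ℂ)` is Borel (Suslin). [folklore] -/
theorem stub_measurableToPathSpace : (∀ (X : Type) [MeasurableSpace X] [MeasurableSpace C(unitInterval, ℂ)] [BorelSpace C(unitInterval, ℂ)] (f : X → C(unitInterval, ℂ)), (∀ r : unitInterval, Measurable (fun x => f x r)) → Measurable f) ∧ (∀ [MeasurableSpace C(unitInterval, ℂ)] [BorelSpace C(unitInterval, ℂ)] (g : Literature.Probability.RandomPlanarGeometry.CurveClass ℂ → C(unitInterval, ℂ)) (ĝ : C(unitInterval, ℂ) → C(unitInterval, ℂ)), Measurable ĝ → (∀ γ : C(unitInterval, ℂ), g (Literature.Probability.RandomPlanarGeometry.CurveClass.mk (Literature.Probability.RandomPlanarGeometry.Curve.mk γ)) = ĝ γ) → Measurable g) :=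
  ⟨fun _ _ _ _ _ hf => measurable_toPath_of_eval hf,
    fun {_ _} _ _ hĝ h => measurable_toPath_of_lift hĝ h⟩

end Summit.CriticalPhenomena.SAWScalingLimit.Theorems.AxiomsOfLimitMarkov

end
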